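import Mathlib
import Literature.NumberTheory.Transcendental.KZCalculus
import Literature.NumberTheory.Transcendental.KZLogCalculusProofs
import Literature.NumberTheory.Transcendental.EllIterRepShuffle
import Literature.NumberTheory.Transcendental.EllIterRep
import Literature.NumberTheory.Transcendental.SemialgebraicMapsProofs
import Literature.NumberTheory.Transcendental.KZBallPeelingAux
import HarnessLib

/-!
# Crux `TorsionLogs.NeronTorsionSector` (stmt-KontsevichZagierPeriods-14500) — assembly, grid decompositions

Helpers for the lead's stub `stub_assembly` (line `registered`): rule (1a) decompositions of the two
second-kind plane representations of the translation chain along the torsion grid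
`x 1 > x 2 > ⋯ > x m = e₁` (rows `row 0 = (x 1, ∞)`, `row j = (x (j+1), x j)`):
`ℍ(□)`, `□ = (e₁,∞)²`, is the sum of its `m²` cells, and `ℍ(T)`, `T = {e₁ < x′ < x < x_aa}`, is the sum of
the diagonal half-cells `t_i` (`aa ≤ i < m`) and the cells `(i, j)`, `aa ≤ i < j < m` — up to the null grid
lines (`KZ.of_sub_sum_of_mem_relations_of_subset`, restrictions as pieces).
[cite: KontsevichZagier2001, §1.2 rule (1)]
-/

noncomputable section

open Set MeasureTheory
open Literature.NumberTheory.Transcendental Literature.NumberTheory.Transcendental.KZ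
open Literature.ModelTheory.ExponentialFields

-- `Summit.KontsevichZagierPeriods.KontsevichZagierPeriods.…` is the tree's mandated layout (single-conjunct summit).
set_option linter.dupNamespace false

namespace Summit.KontsevichZagierPeriods.KontsevichZagierPeriods.Cruxes.NeronTorsionSector.Translation

/-- **Grid locator.** For a strictly decreasing grid `x 1 > x 2 > ⋯ > x m` and `t > x m`, either `t > x 1`, or
`t` is a grid point `x k` (`1 ≤ k < m`), or `t` lies in an open cell `(x (k+1), x k)` (`1 ≤ k < m`). [folklore] -/
theorem asmDecomp_locate (x : ℕ → ℝ) (m : ℕ) (hm : 1 ≤ m) {t : ℝ} (ht : x m < t) :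
    x 1 < t ∨ (∃ k, 1 ≤ k ∧ k < m ∧ t = x k) ∨ (∃ k, 1 ≤ k ∧ k < m ∧ x (k + 1) < t ∧ t < x k) := by
  classical
  have hex : ∃ k, 1 ≤ k ∧ k ≤ m ∧ x k < t := ⟨m, hm, le_rfl, ht⟩
  obtain ⟨hk₀1, hk₀m, hk₀t⟩ := Nat.find_spec hex
  set k₀ := Nat.find hex with hk₀
  by_cases h1 : k₀ = 1
  · left; rw [h1] at hk₀t; exact hk₀t
  · have hk₀2 : 2 ≤ k₀ := by omega
    have hmin : ¬ (x (k₀ - 1) < t) := by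
      intro hlt
      have := Nat.find_min hex (show k₀ - 1 < k₀ by omega)
      exact this ⟨by omega, by omega, hlt⟩
    have hmin' : t ≤ x (k₀ - 1) := le_of_not_gt hmin
    rcases hmin'.lt_or_eq with hlt | heq
    · right; right
      refine ⟨k₀ - 1, by omega, by omega, ?_, hlt⟩
      have : k₀ - 1 + 1 = k₀ := by omega
      rw [this]; exact hk₀t
    · right; left
      exact ⟨k₀ - 1, by omega, by omega, heq⟩

/-- The `m × m` grid cells of `(e₁, ∞)²` miss only grid lines: a point of `(e₁,∞)²` outside every cell
`row i × row j` has a coordinate equal to a grid value `x k`, `1 ≤ k < m`. [folklore] -/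
theorem asmDecomp_box_cover (x : ℕ → ℝ) (m : ℕ) (hm : 1 ≤ m) (row : ℕ → Set ℝ)
    (hrow0 : row 0 = Set.Ioi (x 1)) (hrow : ∀ j, 1 ≤ j → row j = Set.Ioo (x (j + 1)) (x j))
    (z : Fin 2 → ℝ) (hz0 : x m < z 0) (hz1 : x m < z 1)
    (hout : ∀ i j, i < m → j < m → ¬ (z 0 ∈ row i ∧ z 1 ∈ row j)) :
    ∃ k, 1 ≤ k ∧ k < m ∧ (z 0 = x k ∨ z 1 = x k) := by
  have loc : ∀ t, x m < t → (∃ i, i < m ∧ t ∈ row i) ∨ (∃ k, 1 ≤ k ∧ k < m ∧ t = x k) := by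
    intro t ht
    rcases asmDecomp_locate x m hm ht with h | ⟨k, hk1, hkm, hk⟩ | ⟨k, hk1, hkm, hk, hk'⟩
    · left; exact ⟨0, by omega, by rw [hrow0]; exact h⟩
    · right; exact ⟨k, hk1, hkm, hk⟩
    · left; exact ⟨k, hkm, by rw [hrow k hk1]; exact ⟨hk, hk'⟩⟩
  rcases loc _ hz0 with ⟨i, him, hi⟩ | ⟨k, hk1, hkm, hk⟩
  · rcases loc _ hz1 with ⟨j, hjm, hj⟩ | ⟨k, hk1, hkm, hk⟩
    · exact absurd ⟨hi, hj⟩ (hout i j him hjm)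
    · exact ⟨k, hk1, hkm, Or.inr hk⟩
  · exact ⟨k, hk1, hkm, Or.inl hk⟩

/-- The union of the grid hyperplanes `{z 0 = x k} ∪ {z 1 = x k}`, `1 ≤ k < m`, is null. [folklore] -/
theorem asmDecomp_volume_gridLines (x : ℕ → ℝ) (m : ℕ) :
    volume {z : Fin 2 → ℝ | ∃ k, 1 ≤ k ∧ k < m ∧ (z 0 = x k ∨ z 1 = x k)} = 0 := by
  have hsub : {z : Fin 2 → ℝ | ∃ k, 1 ≤ k ∧ k < m ∧ (z 0 = x k ∨ z 1 = x k)} ⊆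
      ⋃ k ∈ Finset.range m, ({z : Fin 2 → ℝ | z 0 = x k} ∪ {z : Fin 2 → ℝ | z 1 = x k}) := by
    intro z ⟨k, _, hkm, hk⟩
    simp only [mem_iUnion, Finset.mem_range, mem_union, mem_setOf_eq]
    exact ⟨k, hkm, hk⟩
  refine measure_mono_null hsub ?_
  refine (measure_biUnion_null_iff (Finset.countable_toSet _)).mpr fun k _ => ?_
  exact measure_union_null (KZ.BallPeeling.volume_setOf_apply_eq_const 2 0 (x k))
    (KZ.BallPeeling.volume_setOf_apply_eq_const 2 1 (x k))

/-- A row `row j` (`= (x 1, ∞)` or `(x (j+1), x j)`) with algebraic end points defines `ℚ`-semialgebraic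
cylinder conditions `{z | z i ∈ row j}` in the plane. [cite: BochnakCosteRoy1998, §2.2] -/
theorem asmDecomp_isSemialgebraic_row (x : ℕ → ℝ) (m : ℕ) (halg : ∀ k, 1 ≤ k → k ≤ m → IsAlgebraic ℚ (x k))
    (row : ℕ → Set ℝ) (hrow0 : row 0 = Set.Ioi (x 1)) (hrow : ∀ j, 1 ≤ j → row j = Set.Ioo (x (j + 1)) (x j))
    (hm : 1 ≤ m) (j : ℕ) (hj : j < m) (i : Fin 2) :
    IsSemialgebraic ℚ {z : Fin 2 → ℝ | z i ∈ row j} := by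
  rcases Nat.eq_zero_or_pos j with rfl | hjpos
  · rw [hrow0]
    exact isSemialgebraic_setOf_const_lt_apply (halg 1 le_rfl hm) i
  · rw [hrow j hjpos]
    have h1 := isSemialgebraic_setOf_const_lt_apply (n := 2) (halg (j + 1) (by omega) (by omega)) i
    have h2 := isSemialgebraic_setOf_apply_lt_const (n := 2) (halg j hjpos hj.le) i
    have hset : {z : Fin 2 → ℝ | z i ∈ Set.Ioo (x (j + 1)) (x j)} =
        {z : Fin 2 → ℝ | x (j + 1) < z i} ∩ {z : Fin 2 → ℝ | z i < x j} := by
      ext z; simp [Set.mem_Ioo]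
    rw [hset]; exact h1.inter h2

/-- A strictly decreasing grid is antitone on `[1, m]`. [folklore] -/
theorem asmDecomp_anti (x : ℕ → ℝ) (m : ℕ) (hdec : ∀ k, 1 ≤ k → k < m → x (k + 1) < x k) :
    ∀ k l, 1 ≤ k → k ≤ l → l ≤ m → x l ≤ x k := by
  intro k l hk hkl hlm
  induction l, hkl using Nat.le_induction with
  | base => exact le_rfl
  | succ l hkl ih => exact (hdec l (by omega) (by omega)).le.trans (ih (by omega))

/-- A strictly decreasing grid is strictly antitone on `[1, m]`. [folklore] -/
theorem asmDecomp_strictAnti (x : ℕ → ℝ) (m : ℕ) (hdec : ∀ k, 1 ≤ k → k < m → x (k + 1) < x k) :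
    ∀ k l, 1 ≤ k → k < l → l ≤ m → x l < x k := fun k l hk hkl hlm =>
  (asmDecomp_anti x m hdec (k + 1) l (by omega) hkl hlm).trans_lt (hdec k hk (by omega))

/-- Every row lies right of `x m`. [folklore] -/
theorem asmDecomp_row_sub (x : ℕ → ℝ) (m : ℕ) (hm : 1 ≤ m) (hdec : ∀ k, 1 ≤ k → k < m → x (k + 1) < x k)
    (row : ℕ → Set ℝ) (hrow0 : row 0 = Set.Ioi (x 1)) (hrow : ∀ j, 1 ≤ j → row j = Set.Ioo (x (j + 1)) (x j)) :
    ∀ j, j < m → row j ⊆ Set.Ioi (x m) := by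
  intro j hj t ht
  rcases Nat.eq_zero_or_pos j with rfl | hjpos
  · rw [hrow0] at ht
    exact lt_of_le_of_lt (asmDecomp_anti x m hdec 1 m le_rfl hm le_rfl) ht
  · rw [hrow j hjpos] at ht
    exact lt_of_le_of_lt (asmDecomp_anti x m hdec (j + 1) m (by omega) (by omega) le_rfl) ht.1

/-- Rows are ordered: every point of `row j` is left of every point of `row i` for `i < j`. [folklore] -/
theorem asmDecomp_row_lt (x : ℕ → ℝ) (m : ℕ) (hdec : ∀ k, 1 ≤ k → k < m → x (k + 1) < x k)
    (row : ℕ → Set ℝ) (hrow0 : row 0 = Set.Ioi (x 1)) (hrow : ∀ j, 1 ≤ j → row j = Set.Ioo (x (j + 1)) (x j)) :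
    ∀ i j, i < j → j < m → ∀ s ∈ row j, ∀ t ∈ row i, s < t := by
  intro i j hij hjm s hs t ht
  have hjpos : 1 ≤ j := by omega
  rw [hrow j hjpos] at hs
  rcases Nat.eq_zero_or_pos i with rfl | hipos
  · rw [hrow0] at ht
    exact hs.2.trans_le ((asmDecomp_anti x m hdec 1 j le_rfl hjpos hjm.le).trans ht.le)
  · rw [hrow i hipos] at ht
    exact hs.2.trans_le ((asmDecomp_anti x m hdec (i + 1) j (by omega) (by omega) hjm.le).trans ht.1.le)

/-- Distinct rows are disjoint. [folklore] -/
theorem asmDecomp_row_disj (x : ℕ → ℝ) (m : ℕ) (hdec : ∀ k, 1 ≤ k → k < m → x (k + 1) < x k)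
    (row : ℕ → Set ℝ) (hrow0 : row 0 = Set.Ioi (x 1)) (hrow : ∀ j, 1 ≤ j → row j = Set.Ioo (x (j + 1)) (x j)) :
    ∀ i j, i ≠ j → i < m → j < m → Disjoint (row i) (row j) := by
  intro i j hij him hjm
  rw [Set.disjoint_left]
  intro t hti htj
  rcases lt_or_gt_of_ne hij with h | h
  · exact lt_irrefl _ (asmDecomp_row_lt x m hdec row hrow0 hrow i j h hjm t htj t hti)
  · exact lt_irrefl _ (asmDecomp_row_lt x m hdec row hrow0 hrow j i h him t hti t htj)

/-- **Decomposition of `ℍ(□)` into its grid cells.** For a plane representation `r` on `(e₁, ∞)²` (`e₁ = x m`)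
and the grid rows, `[r] − Σ_{i,j<m} [r|_{row i × row j}] ∈ KZ.relations` (rule (1a); the cells are pairwise
disjoint and cover `□` up to the null grid lines). [cite: KontsevichZagier2001, §1.2 rule (1)] -/
theorem asmDecomp_box : ∀ (x : ℕ → ℝ) (m : ℕ) (row : ℕ → Set ℝ) (r : Literature.NumberTheory.Transcendental.KZ.IntegralRep 2), 1 ≤ m → (∀ k, 1 ≤ k → k < m → x (k + 1) < x k) → (∀ k, 1 ≤ k → k ≤ m → IsAlgebraic ℚ (x k)) → row 0 = Set.Ioi (x 1) → (∀ j, 1 ≤ j → row j = Set.Ioo (x (j + 1)) (x j)) → r.domain = {z | x m < z 0 ∧ x m < z 1} → ∃ R : ℕ × ℕ → Literature.NumberTheory.Transcendental.KZ.IntegralRep 2, (∀ i j, i < m → j < m → (R (i, j)).domain = {z | z 0 ∈ row i ∧ z 1 ∈ row j} ∧ (R (i, j)).integrand = r.integrand) ∧ Literature.NumberTheory.Transcendental.KZ.of r - ∑ ij ∈ Finset.range m ×ˢ Finset.range m, Literature.NumberTheory.Transcendental.KZ.of (R ij) ∈ Literature.NumberTheory.Transcendental.KZ.relations := by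
  intro x m row r hm hdec halg hrow0 hrow hrd
  classical
  have hrow_sub := asmDecomp_row_sub x m hm hdec row hrow0 hrow
  have hrow_disj := asmDecomp_row_disj x m hdec row hrow0 hrow
  -- the pieces
  have hcellσ : ∀ i j, i < m → j < m → IsSemialgebraic ℚ {z : Fin 2 → ℝ | z 0 ∈ row i ∧ z 1 ∈ row j} :=
    fun i j hi hj => (asmDecomp_isSemialgebraic_row x m halg row hrow0 hrow hm i hi 0).inter
      (asmDecomp_isSemialgebraic_row x m halg row hrow0 hrow hm j hj 1)
  have hcell_sub : ∀ i j, i < m → j < m → {z : Fin 2 → ℝ | z 0 ∈ row i ∧ z 1 ∈ row j} ⊆ r.domain := by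
    intro i j hi hj z hz
    rw [hrd]
    exact ⟨hrow_sub i hi hz.1, hrow_sub j hj hz.2⟩
  let R : ℕ × ℕ → IntegralRep 2 := fun ij =>
    if h : ij.1 < m ∧ ij.2 < m then
      r.restrict {z | z 0 ∈ row ij.1 ∧ z 1 ∈ row ij.2} (hcellσ ij.1 ij.2 h.1 h.2) (hcell_sub ij.1 ij.2 h.1 h.2)
    else r
  have hR : ∀ i j, i < m → j < m →
      (R (i, j)).domain = {z | z 0 ∈ row i ∧ z 1 ∈ row j} ∧ (R (i, j)).integrand = r.integrand := by
    intro i j hi hj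
    simp only [R, dif_pos (And.intro hi hj), IntegralRep.domain_restrict, IntegralRep.integrand_restrict,
      and_self]
  refine ⟨R, hR, ?_⟩
  refine of_sub_sum_of_mem_relations_of_subset (Finset.range m ×ˢ Finset.range m) r R ?_ ?_ ?_ ?_
  · intro ij hij
    obtain ⟨hi, hj⟩ := Finset.mem_product.mp hij
    rw [(hR ij.1 ij.2 (Finset.mem_range.mp hi) (Finset.mem_range.mp hj)).1]
    exact hcell_sub _ _ (Finset.mem_range.mp hi) (Finset.mem_range.mp hj)
  · intro ij hij
    obtain ⟨hi, hj⟩ := Finset.mem_product.mp hij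
    rw [(hR ij.1 ij.2 (Finset.mem_range.mp hi) (Finset.mem_range.mp hj)).2]
    exact fun _ _ => rfl
  · refine measure_mono_null ?_ (asmDecomp_volume_gridLines x m)
    intro z hz
    obtain ⟨hzr, hzout⟩ := hz
    rw [hrd] at hzr
    refine asmDecomp_box_cover x m hm row hrow0 hrow z hzr.1 hzr.2 fun i j hi hj hin => hzout ?_
    simp only [mem_iUnion, Finset.mem_product, Finset.mem_range, exists_prop]
    exact ⟨(i, j), ⟨hi, hj⟩, by rw [(hR i j hi hj).1]; exact hin⟩
  · intro ij hij kl hkl hne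
    obtain ⟨hi, hj⟩ := Finset.mem_product.mp hij
    obtain ⟨hk, hl⟩ := Finset.mem_product.mp hkl
    rw [Finset.mem_range] at hi hj hk hl
    rw [(hR ij.1 ij.2 hi hj).1, (hR kl.1 kl.2 hk hl).1, Set.disjoint_left]
    intro z hz hz'
    apply hne
    have h1 : ij.1 = kl.1 := by
      by_contra h; exact Set.disjoint_left.mp (hrow_disj _ _ h hi hk) hz.1 hz'.1
    have h2 : ij.2 = kl.2 := by
      by_contra h; exact Set.disjoint_left.mp (hrow_disj _ _ h hj hl) hz.2 hz'.2
    exact Prod.ext h1 h2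

/-- **Decomposition of `ℍ(T)` along the grid.** For a plane representation `r` on the triangle
`T = {x m < z 1 < z 0 < x aa}` (`1 ≤ aa < m`): `[r] − (Σ_{aa ≤ i < m} [t_i] + Σ_{aa ≤ i < j < m} [c_{ij}]) ∈ KZ.relations`,
where `t_i = r|{x (i+1) < z 1 < z 0 < x i}` are the diagonal half-cells and `c_{ij} = r|{z 0 ∈ row i, z 1 ∈ row j}` the
off-diagonal cells (rule (1a); cover up to the null grid lines). [cite: KontsevichZagier2001, §1.2 rule (1)] -/
theorem asmDecomp_triangle : ∀ (x : ℕ → ℝ) (m aa : ℕ) (row : ℕ → Set ℝ) (r : Literature.NumberTheory.Transcendental.KZ.IntegralRep 2), 1 ≤ aa → aa < m → (∀ k, 1 ≤ k → k < m → x (k + 1) < x k) → (∀ k, 1 ≤ k → k ≤ m → IsAlgebraic ℚ (x k)) → row 0 = Set.Ioi (x 1) → (∀ j, 1 ≤ j → row j = Set.Ioo (x (j + 1)) (x j)) → r.domain = {z | x m < z 1 ∧ z 1 < z 0 ∧ z 0 < x aa} → ∃ (Th : ℕ → Literature.NumberTheory.Transcendental.KZ.IntegralRep 2) (R : ℕ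 × ℕ → Literature.NumberTheory.Transcendental.KZ.IntegralRep 2), (∀ i, aa ≤ i → i < m → (Th i).domain = {z | x (i + 1) < z 1 ∧ z 1 < z 0 ∧ z 0 < x i} ∧ (Th i).integrand = r.integrand) ∧ (∀ i j, aa ≤ i → i < j → j < m → (R (i, j)).domain = {z | z 0 ∈ row i ∧ z 1 ∈ row j} ∧ (R (i, j)).integrand = r.integrand) ∧ Literature.NumberTheory.Transcendental.KZ.of r - (∑ i ∈ Finset.Ico aa m, Literature.NumberTheory.Transcendental.KZ.of (Th i) + ∑ i ∈ Finset.Ico aa m, ∑ j ∈ Finset.Ioo i m, Literature.NumberTheory.Transcendental.KZ.of (R (i, j))) ∈ Literature.NumberTheory.Transcendental.KZ.relations := by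
  intro x m aa row r haa haam hdec halg hrow0 hrow hrd
  classical
  have hm : 1 ≤ m := by omega
  have hanti := asmDecomp_anti x m hdec
  have hsanti := asmDecomp_strictAnti x m hdec
  have hrow_lt := asmDecomp_row_lt x m hdec row hrow0 hrow
  have hrow_disj := asmDecomp_row_disj x m hdec row hrow0 hrow
  -- the pieces: half-cells on the diagonal, cells above it
  have hThσ : ∀ i, aa ≤ i → i < m →
      IsSemialgebraic ℚ {z : Fin 2 → ℝ | x (i + 1) < z 1 ∧ z 1 < z 0 ∧ z 0 < x i} := by
    intro i hi him
    have h1 := isSemialgebraic_setOf_const_lt_apply (n := 2) (halg (i + 1) (by omega) (by omega)) 1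
    have h2 : IsSemialgebraic ℚ {z : Fin 2 → ℝ | z 1 < z 0} := by
      have := Literature.ModelTheory.ExponentialFields.isSemialgebraic_setOf_eval_lt (k := ℚ) (R := ℝ)
        (MvPolynomial.X (1 : Fin 2)) (MvPolynomial.X 0)
      simpa using this
    have h3 := isSemialgebraic_setOf_apply_lt_const (n := 2) (halg i (by omega) him.le) 0
    have hset : {z : Fin 2 → ℝ | x (i + 1) < z 1 ∧ z 1 < z 0 ∧ z 0 < x i} =
        ({z : Fin 2 → ℝ | x (i + 1) < z 1} ∩ {z : Fin 2 → ℝ | z 1 < z 0}) ∩ {z : Fin 2 → ℝ | z 0 < x i} := by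
      ext z; simp [and_assoc]
    rw [hset]; exact (h1.inter h2).inter h3
  have hTh_sub : ∀ i, aa ≤ i → i < m → {z : Fin 2 → ℝ | x (i + 1) < z 1 ∧ z 1 < z 0 ∧ z 0 < x i} ⊆ r.domain := by
    intro i hi him z ⟨h1, h2, h3⟩
    rw [hrd]
    exact ⟨(hanti (i + 1) m (by omega) (by omega) le_rfl).trans_lt h1, h2,
      h3.trans_le (hanti aa i haa hi him.le)⟩
  have hcellσ : ∀ i j, i < m → j < m → IsSemialgebraic ℚ {z : Fin 2 → ℝ | z 0 ∈ row i ∧ z 1 ∈ row j} :=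
    fun i j hi hj => (asmDecomp_isSemialgebraic_row x m halg row hrow0 hrow hm i hi 0).inter
      (asmDecomp_isSemialgebraic_row x m halg row hrow0 hrow hm j hj 1)
  have hcell_sub : ∀ i j, aa ≤ i → i < j → j < m → {z : Fin 2 → ℝ | z 0 ∈ row i ∧ z 1 ∈ row j} ⊆ r.domain := by
    intro i j hi hij hjm z ⟨hz0, hz1⟩
    have hipos : 1 ≤ i := by omega
    have hjpos : 1 ≤ j := by omega
    have hlt := hrow_lt i j hij hjm _ hz1 _ hz0
    rw [hrow i hipos] at hz0
    rw [hrow j hjpos] at hz1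
    rw [hrd]
    exact ⟨(hanti (j + 1) m (by omega) (by omega) le_rfl).trans_lt hz1.1, hlt,
      hz0.2.trans_le (hanti aa i haa hi (by omega))⟩
  let Th : ℕ → IntegralRep 2 := fun i =>
    if h : aa ≤ i ∧ i < m then r.restrict _ (hThσ i h.1 h.2) (hTh_sub i h.1 h.2) else r
  let R : ℕ × ℕ → IntegralRep 2 := fun ij =>
    if h : aa ≤ ij.1 ∧ ij.1 < ij.2 ∧ ij.2 < m then
      r.restrict _ (hcellσ ij.1 ij.2 (by omega) h.2.2) (hcell_sub ij.1 ij.2 h.1 h.2.1 h.2.2) else r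
  have hTh : ∀ i, aa ≤ i → i < m →
      (Th i).domain = {z | x (i + 1) < z 1 ∧ z 1 < z 0 ∧ z 0 < x i} ∧ (Th i).integrand = r.integrand := by
    intro i hi him
    simp only [Th, dif_pos (And.intro hi him), IntegralRep.domain_restrict, IntegralRep.integrand_restrict,
      and_self]
  have hR : ∀ i j, aa ≤ i → i < j → j < m →
      (R (i, j)).domain = {z | z 0 ∈ row i ∧ z 1 ∈ row j} ∧ (R (i, j)).integrand = r.integrand := by
    intro i j hi hij hjm
    simp only [R, dif_pos (show aa ≤ i ∧ i < j ∧ j < m from ⟨hi, hij, hjm⟩), IntegralRep.domain_restrict,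
      IntegralRep.integrand_restrict, and_self]
  refine ⟨Th, R, hTh, hR, ?_⟩
  -- one index set for all pieces
  let P : ℕ × ℕ → IntegralRep 2 := fun ij => if ij.1 = ij.2 then Th ij.1 else R ij
  let s : Finset (ℕ × ℕ) := (Finset.Ico aa m ×ˢ Finset.range m).filter fun ij => ij.1 ≤ ij.2
  have hmem_s : ∀ ij, ij ∈ s ↔ aa ≤ ij.1 ∧ ij.1 ≤ ij.2 ∧ ij.2 < m := by
    intro ij
    simp only [s, Finset.mem_filter, Finset.mem_product, Finset.mem_Ico, Finset.mem_range]
    omega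
  have hPdom : ∀ ij ∈ s, (P ij).domain ⊆ r.domain ∧ Set.EqOn (P ij).integrand r.integrand (P ij).domain := by
    intro ij hij
    obtain ⟨h1, h2, h3⟩ := (hmem_s ij).mp hij
    by_cases heq : ij.1 = ij.2
    · simp only [P, if_pos heq]
      rw [(hTh ij.1 h1 (by omega)).1, (hTh ij.1 h1 (by omega)).2]
      exact ⟨hTh_sub ij.1 h1 (by omega), fun _ _ => rfl⟩
    · simp only [P, if_neg heq]
      rw [(hR ij.1 ij.2 h1 (by omega) h3).1, (hR ij.1 ij.2 h1 (by omega) h3).2]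
      exact ⟨hcell_sub ij.1 ij.2 h1 (by omega) h3, fun _ _ => rfl⟩
  have hsum : ∑ ij ∈ s, of (P ij) =
      ∑ i ∈ Finset.Ico aa m, of (Th i) + ∑ i ∈ Finset.Ico aa m, ∑ j ∈ Finset.Ioo i m, of (R (i, j)) := by
    rw [Finset.sum_filter, Finset.sum_product, ← Finset.sum_add_distrib]
    refine Finset.sum_congr rfl fun i hi => ?_
    rw [Finset.mem_Ico] at hi
    have hfil : ∑ j ∈ Finset.range m, (if i ≤ j then of (P (i, j)) else 0) = ∑ j ∈ Finset.Ico i m, of (P (i, j)) := by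
      rw [← Finset.sum_filter]
      congr 1
      ext j; simp only [Finset.mem_filter, Finset.mem_range, Finset.mem_Ico]; omega
    rw [hfil, ← Finset.Ioo_insert_left hi.2, Finset.sum_insert (by simp)]
    congr 1
    · simp [P]
    · refine Finset.sum_congr rfl fun j hj => ?_
      rw [Finset.mem_Ioo] at hj
      simp only [P, if_neg (show ¬ i = j by omega)]
  rw [← hsum]
  refine of_sub_sum_of_mem_relations_of_subset s r P (fun ij hij => (hPdom ij hij).1)
    (fun ij hij => (hPdom ij hij).2) ?_ ?_
  · -- cover up to grid lines
    refine measure_mono_null ?_ (asmDecomp_volume_gridLines x m)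
    intro z hz
    obtain ⟨hzr, hzout⟩ := hz
    rw [hrd] at hzr
    obtain ⟨hz1, hz10, hz0⟩ := hzr
    simp only [mem_iUnion, exists_prop, not_exists, not_and] at hzout
    have haa1 : x aa ≤ x 1 := hanti 1 aa le_rfl haa haam.le
    -- locate `z 0`
    rcases asmDecomp_locate x m hm (hz1.trans hz10) with h | ⟨k, hk1, hkm, hk⟩ | ⟨k, hk1, hkm, hk, hk'⟩
    · exact absurd (hz0.trans_le haa1) (not_lt.mpr h.le)
    · exact ⟨k, hk1, hkm, Or.inl hk⟩
    · -- `z 0 ∈ row k` with `aa ≤ k`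
      have hkaa : aa ≤ k := by
        by_contra hlt
        exact absurd (hk.trans hz0) (not_lt.mpr (hanti (k + 1) aa (by omega) (by omega) haam.le))
      -- locate `z 1`
      rcases asmDecomp_locate x m hm hz1 with h' | ⟨l, hl1, hlm, hl⟩ | ⟨l, hl1, hlm, hl, hl'⟩
      · exact absurd ((hz10.trans hz0).trans_le haa1) (not_lt.mpr h'.le)
      · exact ⟨l, hl1, hlm, Or.inr hl⟩
      · exfalso
        rcases lt_trichotomy l k with hlk | rfl | hkl
        · -- row l is right of row k: contradicts z 1 < z 0
          have := hrow_lt l k hlk hkm (z 0) (by rw [hrow k hk1]; exact ⟨hk, hk'⟩) (z 1)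
            (by rw [hrow l hl1]; exact ⟨hl, hl'⟩)
          exact absurd hz10 (not_lt.mpr this.le)
        · -- same row: the half-cell
          refine hzout (l, l) ((hmem_s _).mpr ⟨hkaa, le_rfl, hkm⟩) ?_
          simp only [P, if_pos rfl]
          rw [(hTh l hkaa hkm).1]
          exact ⟨hl, hz10, hk'⟩
        · refine hzout (k, l) ((hmem_s _).mpr ⟨hkaa, hkl.le, hlm⟩) ?_
          simp only [P, if_neg (show ¬ k = l by omega)]
          rw [(hR k l hkaa hkl hlm).1, hrow k hk1, hrow l hl1]
          exact ⟨⟨hk, hk'⟩, ⟨hl, hl'⟩⟩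
  · -- pairwise disjoint
    intro ij hij kl hkl hne
    obtain ⟨h1, h2, h3⟩ := (hmem_s ij).mp hij
    obtain ⟨h1', h2', h3'⟩ := (hmem_s kl).mp hkl
    -- each piece sits in `row ij.1 × row ij.2`
    have hsubP : ∀ ij ∈ s, (P ij).domain ⊆ {z | z 0 ∈ row ij.1 ∧ z 1 ∈ row ij.2} := by
      intro ij hij z hz
      obtain ⟨h1, h2, h3⟩ := (hmem_s ij).mp hij
      by_cases heq : ij.1 = ij.2
      · simp only [P, if_pos heq] at hz
        rw [(hTh ij.1 h1 (by omega)).1] at hz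
        rw [← heq, hrow ij.1 (by omega)]
        exact ⟨⟨hz.1.trans hz.2.1, hz.2.2⟩, ⟨hz.1, hz.2.1.trans hz.2.2⟩⟩
      · simp only [P, if_neg heq] at hz
        rwa [(hR ij.1 ij.2 h1 (by omega) h3).1] at hz
    rw [Set.disjoint_left]
    intro z hz hz'
    have hz₁ := hsubP ij hij hz
    have hz₂ := hsubP kl hkl hz'
    apply hne
    have e1 : ij.1 = kl.1 := by
      by_contra h; exact Set.disjoint_left.mp (hrow_disj _ _ h (by omega) (by omega)) hz₁.1 hz₂.1
    have e2 : ij.2 = kl.2 := by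
      by_contra h; exact Set.disjoint_left.mp (hrow_disj _ _ h h3 h3') hz₁.2 hz₂.2
    exact Prod.ext e1 e2

end Summit.KontsevichZagierPeriods.KontsevichZagierPeriods.Cruxes.NeronTorsionSector.Translation
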